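import Literature.Computability.AlgebraicComplexity.LandsbergRessayreNormalForm
import Literature.Computability.AlgebraicComplexity.VonZurGathenSingPermHeight
import Literature.Computability.AlgebraicComplexity.DeterminantalComplexityProofs
import Literature.Computability.AlgebraicComplexity.StandardFamiliesProofs
import Literature.Computability.AlgebraicComplexity.SymbolicMatrixDecomposition
import Literature.Computability.AlgebraicComplexity.DetReprEquivalent
import Literature.Computability.AlgebraicComplexity.CharpolyCoeffPowTrace

/-!
# Crux `DetQP.DetqpSuperquadratic` (stmt-ValiantsHypothesis-0318), line
# `linear-homogenisation-transfer` — stub `stub_vertexGauge` (S1a): the vertex gauge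

Every affine determinantal expression `A = A₀ + A₁(x)` of the permanent `per_n` (`n ≥ 3`, over `ℂ`)
of size `w + 1` yields a **bordered adjugate form** of width `w`:
`per_n = ρᵀ adj(1 + L) γ` with `ρ, γ ∈ (S¹)^w` and `L ∈ M_w(S¹)` homogeneous LINEAR, `S = ℂ[x_ij]`
(Chatterjee–Kumar–Volk 2024, Thm. 13, first half of its proof, specialised to the permanent through
von zur Gathen's regularity theorem; in the line it feeds S1b, the Krylov identities).

Proof of `stub_vertexGauge`.  By von zur Gathen (`vonzurGathen1987_perm_detRepr_rank_holds`) the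
expression is regular (`isRegularDetRepr_perPoly`), so constant invertible `V, U` move its constant
part to `Λ_{i₀}` = the identity with a single `0` at `i₀` (`IsRegularDetRepr.exists_normalForm`);
`det (V A U) = c · per_n` with `c = det V · det U ≠ 0`, and the entries stay affine.  Reindex along
`e : Unit ⊕ Fin w ≃ Fin (w + 1)` with `e (inl ()) = i₀` and split each entry into its constant and
its linear part: the matrix becomes `fromBlocks ℓ ρᵀ γ (1 + L)` with `ℓ, ρ, γ, L` homogeneous of
degree `1`.  The bordered determinant `det = ℓ · det (1 + L) − ρᵀ adj(1 + L) γ` (`det_bordered`,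
over a domain, usable because `det (1 + L)` has constant coefficient `1`) and the comparison of the
homogeneous components of degree `1` (`per_n` is homogeneous of degree `n ≥ 3`) force `ℓ = 0`;
rescaling `ρ` by `−c⁻¹` finishes.  Helpers live in the sub-namespace `VertexGauge`.
-/

noncomputable section

-- `Summit.ValiantsHypothesis.ValiantsHypothesis.…` is the tree's mandated single-conjunct layout
-- (Sub = Summit), so the duplicated namespace component is intended.
set_option linter.dupNamespace false

namespace Summit.ValiantsHypothesis.ValiantsHypothesis.Theorems.DetQPDetqpSuperquadratic

open MvPolynomial Matrix
open Literature.Computability.AlgebraicComplexity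

namespace VertexGauge

/-- If the entries of `L` are homogeneous linear forms then `det (1 + L)` has constant
coefficient `1`. [folklore] -/
theorem constantCoeff_det_one_add {σ : Type*} {R : Type*} [CommRing R] {ι : Type*} [Fintype ι]
    [DecidableEq ι] {L : Matrix ι ι (MvPolynomial σ R)} (hL : ∀ i j, (L i j).IsHomogeneous 1) :
    constantCoeff ((1 + L).det) = 1 := by
  rw [RingHom.map_det]
  have : (RingHom.mapMatrix constantCoeff) (1 + L) = (1 : Matrix ι ι R) := by
    ext i j
    rw [RingHom.mapMatrix_apply, Matrix.map_apply, Matrix.add_apply, map_add, Matrix.one_apply,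
      Matrix.one_apply]
    have h0 : constantCoeff (L i j) = 0 := by
      rw [constantCoeff_eq]
      exact (hL i j).coeff_eq_zero (by simp)
    rw [h0, add_zero]
    split_ifs <;> simp
  rw [this, Matrix.det_one]

/-- **Bordered determinant** over a domain: if `det D ≠ 0` then
`det [[ℓ, ρᵀ], [γ, D]] = ℓ · det D − ρᵀ adj(D) γ` (multiply on the left by
`[[det D, −ρᵀ adj D], [0, 1]]` and cancel `det D`). [folklore] -/
theorem det_bordered {S : Type*} [CommRing S] [IsDomain S] {w : ℕ} (ℓ : S) (ρ γ : Fin w → S)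
    (D : Matrix (Fin w) (Fin w) S) (hD : D.det ≠ 0) :
    (fromBlocks (of fun (_ _ : Unit) => ℓ) (replicateRow Unit ρ) (replicateCol Unit γ) D).det =
      ℓ * D.det - ρ ⬝ᵥ (D.adjugate *ᵥ γ) := by
  set X := fromBlocks (of fun (_ _ : Unit) => ℓ) (replicateRow Unit ρ) (replicateCol Unit γ) D
    with hX
  -- left multiplier `P = [[det D, −ρᵀ adj D], [0, 1]]`
  set P : Matrix (Unit ⊕ Fin w) (Unit ⊕ Fin w) S :=
    fromBlocks (of fun (_ _ : Unit) => D.det) (-(replicateRow Unit ρ * D.adjugate)) 0 1 with hP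
  have hPX : P * X = fromBlocks (of fun (_ _ : Unit) => ℓ * D.det - ρ ⬝ᵥ (D.adjugate *ᵥ γ)) 0
      (replicateCol Unit γ) D := by
    rw [hP, hX, fromBlocks_multiply]
    have h12 : of (fun (_ _ : Unit) => D.det) * replicateRow Unit ρ +
        -(replicateRow Unit ρ * D.adjugate) * D = 0 := by
      rw [Matrix.neg_mul, Matrix.mul_assoc, adjugate_mul, Matrix.mul_smul, Matrix.mul_one]
      ext i j
      simp [Matrix.mul_apply]
    have h11 : of (fun (_ _ : Unit) => D.det) * of (fun (_ _ : Unit) => ℓ) +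
        -(replicateRow Unit ρ * D.adjugate) * replicateCol Unit γ =
          of fun (_ _ : Unit) => ℓ * D.det - ρ ⬝ᵥ (D.adjugate *ᵥ γ) := by
      rw [Matrix.neg_mul, ← replicateRow_vecMul, replicateRow_mul_replicateCol,
        ← dotProduct_mulVec]
      ext i j
      simp only [Matrix.add_apply, Matrix.mul_apply, Matrix.neg_apply, of_apply,
        Fintype.sum_unique]
      ring
    rw [h11, h12]
    simp
  have hdetP : P.det = D.det := by
    rw [hP, det_fromBlocks_zero₂₁, det_unique, Matrix.det_one, mul_one, of_apply]
  have h1 : (P * X).det = D.det * X.det := by rw [det_mul, hdetP]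
  have h2 : (P * X).det = (ℓ * D.det - ρ ⬝ᵥ (D.adjugate *ᵥ γ)) * D.det := by
    rw [hPX, det_fromBlocks_zero₁₂, det_unique, of_apply]
  have h3 : D.det * X.det = D.det * (ℓ * D.det - ρ ⬝ᵥ (D.adjugate *ᵥ γ)) := by
    rw [← h1, h2, mul_comm]
  exact mul_left_cancel₀ hD h3

end VertexGauge

/-- **Stub `stub_vertexGauge` (S1a) of line `linear-homogenisation-transfer`: the vertex gauge.**
Every affine determinantal expression of `per_n` (`n ≥ 3`, over `ℂ`) of size `w + 1` yields
homogeneous linear `ρ, γ : (S¹)^w` and `L ∈ M_w(S¹)` with `ρᵀ adj(1 + L) γ = per_n`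
(von zur Gathen regularity + Landsberg–Ressayre normal form + bordered determinant + comparison
of degree-one components; Chatterjee–Kumar–Volk 2024, Thm. 13, first half of the proof, for the
permanent via their Cor. 14). [cite: ChatterjeeKumarVolk2024, Thm. 13] -/
theorem stub_vertexGauge :
    ∀ n : ℕ, 3 ≤ n → ∀ w : ℕ, HasDetRepr (perPoly (Fin n) ℂ) (w + 1) →
      ∃ (ρ γ : Fin w → MvPolynomial (Fin n × Fin n) ℂ)
        (L : Matrix (Fin w) (Fin w) (MvPolynomial (Fin n × Fin n) ℂ)),
        (∀ i, (ρ i).IsHomogeneous 1) ∧ (∀ i, (γ i).IsHomogeneous 1) ∧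
        (∀ i j, (L i j).IsHomogeneous 1) ∧
        ρ ⬝ᵥ ((1 + L).adjugate *ᵥ γ) = perPoly (Fin n) ℂ := by
  intro n hn w h
  classical
  obtain ⟨A, hAaff, hAdet⟩ := h
  -- regularity (von zur Gathen) and the Landsberg–Ressayre normal form of the constant part
  have hreg : IsRegularDetRepr (perPoly (Fin n) ℂ) A :=
    isRegularDetRepr_perPoly vonzurGathen1987_perm_detRepr_rank_holds hn ⟨hAaff, hAdet⟩
  obtain ⟨V, U, i₀, hV, hU, hΛ⟩ := hreg.exists_normalForm (by omega : 0 < w + 1)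
  set B : Matrix (Fin (w + 1)) (Fin (w + 1)) (MvPolynomial (Fin n × Fin n) ℂ) :=
    V.map C * A * U.map C with hB
  -- `det B = C c * per_n` with `c = det V * det U ≠ 0`; the entries of `B` are affine
  have hBdet : B.det = C (V.det * U.det) * perPoly (Fin n) ℂ := by
    rw [hB, det_map_C_mul_mul_map_C, hAdet]
  set c : ℂ := V.det * U.det
  have hc0 : c ≠ 0 := mul_ne_zero ((Matrix.isUnit_iff_isUnit_det V).1 hV).ne_zero
    ((Matrix.isUnit_iff_isUnit_det U).1 hU).ne_zero
  have hBaff : ∀ i j, (B i j).totalDegree ≤ 1 := totalDegree_map_C_mul_mul_map_C_le V U hAaff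
  have hBconst : ∀ i j, constantCoeff (B i j) = lamMatrix ℂ i₀ i j := by
    intro i j
    have := congrFun (congrFun hΛ i) j
    rwa [constPart_apply] at this
  -- reindex along `e : Unit ⊕ Fin w ≃ Fin (w + 1)` with `e (inl ()) = i₀`
  set e : Unit ⊕ Fin w ≃ Fin (w + 1) := (Equiv.sumComm Unit (Fin w)).trans
    ((Equiv.optionEquivSumPUnit (Fin w)).symm.trans (finSuccEquiv' i₀).symm) with he
  have he0 : e (Sum.inl ()) = i₀ := by
    simp [he]
  have heq : ∀ x : Unit ⊕ Fin w, e x = i₀ ↔ x = Sum.inl () := by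
    intro x
    constructor
    · intro hx
      exact e.injective (hx.trans he0.symm)
    · rintro rfl
      exact he0
  set B' : Matrix (Unit ⊕ Fin w) (Unit ⊕ Fin w) (MvPolynomial (Fin n × Fin n) ℂ) :=
    B.submatrix e e with hB'
  have hB'det : B'.det = C c * perPoly (Fin n) ℂ := by
    rw [hB', det_submatrix_equiv_self, hBdet]
  have hB'aff : ∀ x y, (B' x y).totalDegree ≤ 1 := fun x y => hBaff _ _
  have hB'const : ∀ x y, coeff 0 (B' x y) =
      if x = y then (if x = Sum.inl () then 0 else 1) else 0 := by
    intro x y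
    rw [hB', submatrix_apply, ← constantCoeff_eq, hBconst, lamMatrix_apply]
    simp only [EmbeddingLike.apply_eq_iff_eq, heq]
  -- the linear parts `ℓ, ρ, γ, L`
  set ℓ : MvPolynomial (Fin n × Fin n) ℂ :=
    homogeneousComponent 1 (B' (Sum.inl ()) (Sum.inl ())) with hℓ
  set ρ : Fin w → MvPolynomial (Fin n × Fin n) ℂ :=
    fun j => homogeneousComponent 1 (B' (Sum.inl ()) (Sum.inr j)) with hρ
  set γ : Fin w → MvPolynomial (Fin n × Fin n) ℂ :=
    fun i => homogeneousComponent 1 (B' (Sum.inr i) (Sum.inl ())) with hγ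
  set Lm : Matrix (Fin w) (Fin w) (MvPolynomial (Fin n × Fin n) ℂ) :=
    Matrix.of fun i j => homogeneousComponent 1 (B' (Sum.inr i) (Sum.inr j)) with hLm
  have hℓhom : ℓ.IsHomogeneous 1 := homogeneousComponent_isHomogeneous 1 _
  have hρhom : ∀ j, (ρ j).IsHomogeneous 1 := fun j => homogeneousComponent_isHomogeneous 1 _
  have hγhom : ∀ i, (γ i).IsHomogeneous 1 := fun i => homogeneousComponent_isHomogeneous 1 _
  have hLhom : ∀ i j, (Lm i j).IsHomogeneous 1 := fun i j => homogeneousComponent_isHomogeneous 1 _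
  have hB'eq : B' = fromBlocks (of fun (_ _ : Unit) => ℓ) (replicateRow Unit ρ)
      (replicateCol Unit γ) (1 + Lm) := by
    ext x y
    rw [PowTraceFromDetRepr.eq_C_add_homogeneousComponent_one (B' x y) (hB'aff x y), hB'const]
    rcases x with ⟨⟨⟩⟩ | i <;> rcases y with ⟨⟨⟩⟩ | j
    · simp [hℓ]
    · simp [hρ]
    · simp [hγ]
    · rw [fromBlocks_apply₂₂, Matrix.add_apply, Matrix.one_apply, hLm, of_apply]
      by_cases hij : i = j
      · subst hij
        simp
      · simp [hij]
  -- the bordered determinant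
  have hq : (1 + Lm).det ≠ 0 := by
    intro h0
    have := VertexGauge.constantCoeff_det_one_add hLhom
    rw [h0, map_zero] at this
    exact zero_ne_one this
  have hexp : ℓ * (1 + Lm).det - ρ ⬝ᵥ ((1 + Lm).adjugate *ᵥ γ) = C c * perPoly (Fin n) ℂ := by
    rw [← VertexGauge.det_bordered ℓ ρ γ (1 + Lm) hq, ← hB'eq, hB'det]
  -- comparison of the homogeneous components of degree one (graded pieces of `ℂ[x]`): `ℓ = 0`
  have hper : (perPoly (Fin n) ℂ).IsHomogeneous n := by
    simpa using (perPoly_isHomogeneous (n := Fin n) (k := ℂ))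
  letI := MvPolynomial.gradedAlgebra (σ := Fin n × Fin n) (R := ℂ)
  have hdec : ∀ (φ : MvPolynomial (Fin n × Fin n) ℂ) (i : ℕ),
      ((DirectSum.decompose (homogeneousSubmodule (Fin n × Fin n) ℂ) φ) i :
        MvPolynomial (Fin n × Fin n) ℂ) = homogeneousComponent i φ :=
    fun φ i => decomposition.decompose'_apply φ i
  have hℓ0 : ℓ = 0 := by
    have h1 := congrArg (homogeneousComponent 1) hexp
    have t1 : homogeneousComponent 1 (ℓ * (1 + Lm).det) = ℓ := by
      have := DirectSum.coe_decompose_mul_of_left_mem_of_le (𝒜 := homogeneousSubmodule _ ℂ)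
        (b := (1 + Lm).det) ((mem_homogeneousSubmodule 1 ℓ).2 hℓhom) (le_refl 1)
      rw [hdec, hdec] at this
      rw [this, Nat.sub_self, homogeneousComponent_zero, ← constantCoeff_eq,
        VertexGauge.constantCoeff_det_one_add hLhom, C_1, mul_one]
    have t2 : homogeneousComponent 1 (ρ ⬝ᵥ ((1 + Lm).adjugate *ᵥ γ)) = 0 := by
      simp only [dotProduct, mulVec, Finset.mul_sum, map_sum]
      refine Finset.sum_eq_zero fun a _ => Finset.sum_eq_zero fun b _ => ?_
      have hre : ρ a * ((1 + Lm).adjugate a b * γ b) = (ρ a * γ b) * (1 + Lm).adjugate a b := by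
        ring
      rw [hre]
      have := DirectSum.coe_decompose_mul_of_left_mem_of_not_le (𝒜 := homogeneousSubmodule _ ℂ)
        (b := (1 + Lm).adjugate a b) ((mem_homogeneousSubmodule 2 _).2 ((hρhom a).mul (hγhom b)))
        (by norm_num : ¬ (2 ≤ 1))
      rwa [hdec] at this
    have t3 : homogeneousComponent 1 (C c * perPoly (Fin n) ℂ) = 0 := by
      rw [homogeneousComponent_C_mul, homogeneousComponent_of_mem
        ((mem_homogeneousSubmodule n _).2 hper), if_neg (by omega), mul_zero]
    rw [map_sub, t1, t2, t3, sub_zero] at h1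
    exact h1
  -- conclusion, with `ρ' = −c⁻¹ • ρ`
  have hcontr : ρ ⬝ᵥ ((1 + Lm).adjugate *ᵥ γ) = -(C c * perPoly (Fin n) ℂ) := by
    rw [hℓ0, zero_mul, zero_sub] at hexp
    rw [← hexp, neg_neg]
  refine ⟨fun j => C (-c⁻¹) * ρ j, γ, Lm, fun j => ?_, hγhom, hLhom, ?_⟩
  · simpa using (isHomogeneous_C _ (-c⁻¹)).mul (hρhom j)
  · have : (fun j => C (-c⁻¹) * ρ j) ⬝ᵥ ((1 + Lm).adjugate *ᵥ γ) =
        C (-c⁻¹) * (ρ ⬝ᵥ ((1 + Lm).adjugate *ᵥ γ)) := by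
      simp only [dotProduct, Finset.mul_sum, mul_assoc]
    rw [this, hcontr, mul_neg, ← mul_assoc, ← map_mul, neg_mul, inv_mul_cancel₀ hc0]
    simp

end Summit.ValiantsHypothesis.ValiantsHypothesis.Theorems.DetQPDetqpSuperquadratic
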